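import Mathlib
import Literature.Analysis.Complex.LaplaceHalfLineFourier
import Literature.Analysis.FunctionSpaces.PlancherelL1L2
import Summits.AnomalousDissipation.AnomalousDissipation.Theorems.SoloBlindShiftedLineMass

/-!
# Solo-blind kernel #267 — the `H²` hypothesis of `[A′](a)` from a strip envelope

Kernel #266 (`SoloBlindShiftedLineMass`) turns `[A′](a)` into a theorem under the QUALITATIVE
hypothesis "the continuation `F` of `𝓛k` is `H²` on a half-plane `{Re s > a}`" (some `M` with
`∫ ‖F(σ+iy)‖² dy ≤ M²` for all `σ > a`).  This file discharges that hypothesis from what LEMMA P and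
the outer lemma actually certify (ENGINE-L-SPEC §13(a),(g), §15(k),(o)): an envelope
`‖F(σ + iy)‖ ≤ C/√(1+y²)` on a closed strip `a < σ ≤ b` with `b > γ` (`γ` = exponential order of
`k`).  To the right of the strip (`σ > b > γ`) the line integrals are controlled by Plancherel for
the absolutely convergent Laplace transform: `∫ ‖𝓛k(σ+iy)‖² dy = 2π ∫₀^∞ ‖k‖² e^{−2σt} ≤ πK²/(σ−γ)`.

* `integral_norm_sq_laplaceC_vertical` — Plancherel on a vertical line `Re s = u > γ` (value);
* `integral_norm_sq_bromwichDensity_le` — `‖e^{−u·}k 1_{[0,∞)}‖₂² ≤ K²/(2(u−γ))`;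
* `hardy_of_strip_decay` — the `H²` constant `M² = πC² + πK²/(b−γ)`;
* `Aprime_mass_le_of_strip_decay` — `[A′](a)` with the strip envelope in place of the `H²`
  hypothesis: `∫₀^∞ ‖k‖ e^{γ_ε t} ≤ √(Q₀′/(2γ₂))`, `Q₀′ = (2π)⁻¹∫‖F(−γ′+iω)‖²dω`, `γ′ = γ_ε + γ₂`,
  whenever `a < −γ′`.  The values of `C`, `b` never enter the bound.
-/

noncomputable section

namespace Summit.AnomalousDissipation.SoloBlind.HardyFromDecay

open MeasureTheory Complex Set Filter
open scoped Topology FourierTransform Real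

open Literature.Analysis.Complex

variable {k : ℝ → ℂ} {K γ : ℝ} {F : ℂ → ℂ}

/-- **Plancherel on a vertical line** (value form): for `u > γ`,
`∫ ‖𝓛k(u+iy)‖² dy = 2π ∫ ‖e^{−ut} 1_{[0,∞)}(t) k(t)‖² dt`. -/
theorem integral_norm_sq_laplaceC_vertical (hk : HalfLineExpBound k K γ) {u : ℝ} (hu : γ < u) :
    ∫ y : ℝ, ‖laplaceC k (u + y * I)‖ ^ 2 = 2 * π * ∫ t : ℝ, ‖bromwichDensity k u t‖ ^ 2 := by
  have hP := Literature.Analysis.FunctionSpaces.integral_norm_sq_fourierIntegral_eq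
    (hk.integrable_bromwichDensity hu) (hk.memLp_two_bromwichDensity hu)
  have h := Measure.integral_comp_div (fun ξ : ℝ => ‖𝓕 (bromwichDensity k u) ξ‖ ^ 2) (2 * π)
  rw [abs_of_pos Real.two_pi_pos, smul_eq_mul, hP] at h
  rw [← h]
  refine integral_congr_ae (Eventually.of_forall fun y => ?_)
  simp only [laplaceC_vertical_eq_fourier]

/-- **Weighted `L²` norm of the density**: `∫ ‖e^{−ut} 1_{[0,∞)} k‖² ≤ K²/(2(u−γ))` for `u > γ`. -/
theorem integral_norm_sq_bromwichDensity_le (hk : HalfLineExpBound k K γ) {u : ℝ} (hu : γ < u) :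
    ∫ t : ℝ, ‖bromwichDensity k u t‖ ^ 2 ≤ K ^ 2 / (2 * (u - γ)) := by
  have hdom : ∀ t : ℝ, ‖bromwichDensity k u t‖ ^ 2
      ≤ (Ici (0 : ℝ)).indicator (fun t : ℝ => K ^ 2 * Real.exp ((2 * (γ - u)) * t)) t := by
    intro t
    have hb := hk.norm_bromwichDensity_le u t
    by_cases ht : t ∈ Ici (0 : ℝ)
    · rw [indicator_of_mem ht] at hb ⊢
      calc ‖bromwichDensity k u t‖ ^ 2 ≤ (K * Real.exp ((γ - u) * t)) ^ 2 :=
            pow_le_pow_left₀ (norm_nonneg _) hb 2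
        _ = K ^ 2 * Real.exp ((2 * (γ - u)) * t) := by
            rw [mul_pow, ← Real.exp_nat_mul]; congr 2; push_cast; ring
    · rw [indicator_of_notMem ht] at hb ⊢
      have h0 : ‖bromwichDensity k u t‖ = 0 := le_antisymm hb (norm_nonneg _)
      rw [h0]; norm_num
  have hint : Integrable ((Ici (0 : ℝ)).indicator fun t : ℝ => K ^ 2 * Real.exp ((2 * (γ - u)) * t)) := by
    rw [integrable_indicator_iff measurableSet_Ici, integrableOn_Ici_iff_integrableOn_Ioi]
    exact (integrableOn_exp_mul_Ioi (by linarith) 0).const_mul _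
  calc ∫ t : ℝ, ‖bromwichDensity k u t‖ ^ 2
        ≤ ∫ t : ℝ, (Ici (0 : ℝ)).indicator (fun t : ℝ => K ^ 2 * Real.exp ((2 * (γ - u)) * t)) t :=
          integral_mono_of_nonneg (Eventually.of_forall fun t => by positivity) hint
            (Eventually.of_forall hdom)
    _ = ∫ t in Ioi (0 : ℝ), K ^ 2 * Real.exp ((2 * (γ - u)) * t) := by
          rw [integral_indicator measurableSet_Ici, integral_Ici_eq_integral_Ioi]
    _ = K ^ 2 / (2 * (u - γ)) := by
          rw [integral_const_mul, integral_exp_mul_Ioi (by linarith : 2 * (γ - u) < 0) 0]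
          have h3 : (2 * (γ - u) : ℝ) = -(2 * (u - γ)) := by ring
          rw [mul_zero, Real.exp_zero, h3, neg_div, div_neg, neg_neg, ← div_eq_mul_one_div]

/-- **`H²` from a strip envelope.**  If `F` is holomorphic on `{Re s > a}`, equals `𝓛k` for
`Re s > max(γ, a)` (`k` of exponential order `γ` with constant `K`), and obeys
`‖F(σ+iy)‖ ≤ C/√(1+y²)` for `a < σ ≤ b` with `b > γ`, then all line integrals `∫‖F(σ+iy)‖²dy`,
`σ > a`, are finite and bounded by `M² = πC² + πK²/(b−γ)`. -/
theorem hardy_of_strip_decay (hk : HalfLineExpBound k K γ) {a b C : ℝ} (hγb : γ < b)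
    (hF : DifferentiableOn ℂ F {s : ℂ | a < s.re})
    (hFk : ∀ s : ℂ, γ < s.re → a < s.re → F s = laplaceC k s)
    (hC : ∀ σ y : ℝ, a < σ → σ ≤ b → ‖F (σ + y * I)‖ ≤ C / Real.sqrt (1 + y ^ 2)) :
    ∃ M : ℝ, 0 ≤ M ∧ (∀ σ : ℝ, a < σ → Integrable (fun y : ℝ => ‖F (σ + y * I)‖ ^ 2)) ∧
      (∀ σ : ℝ, a < σ → ∫ y : ℝ, ‖F (σ + y * I)‖ ^ 2 ≤ M ^ 2) := by
  have hK : 0 ≤ K := hk.nonneg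
  obtain ⟨d, hd, hdb⟩ : ∃ d : ℝ, 0 < d ∧ d = b - γ := ⟨b - γ, by linarith, rfl⟩
  obtain ⟨M2, hM2⟩ : ∃ M2 : ℝ, M2 = π * C ^ 2 + π * (K ^ 2 / d) := ⟨_, rfl⟩
  have hπC : 0 ≤ π * C ^ 2 := by positivity
  have hπK : 0 ≤ π * (K ^ 2 / d) := by positivity
  have hM2nn : 0 ≤ M2 := by rw [hM2]; positivity
  have hre : ∀ σ y : ℝ, ((σ : ℂ) + (y : ℂ) * I).re = σ := fun σ y => by simp
  -- continuity along vertical lines inside the half-plane (for measurability)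
  have hcont : ∀ σ : ℝ, a < σ → Continuous fun y : ℝ => F (σ + y * I) := fun σ hσ =>
    hF.continuousOn.comp_continuous (by fun_prop) fun y => by
      simp only [mem_setOf_eq, hre]; exact hσ
  -- pointwise square bound on the strip
  have hsq : ∀ σ y : ℝ, a < σ → σ ≤ b → ‖F (σ + y * I)‖ ^ 2 ≤ C ^ 2 * (1 + y ^ 2)⁻¹ := by
    intro σ y hσ hσb
    calc ‖F (σ + y * I)‖ ^ 2 ≤ (C / Real.sqrt (1 + y ^ 2)) ^ 2 :=
          pow_le_pow_left₀ (norm_nonneg _) (hC σ y hσ hσb) 2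
      _ = C ^ 2 * (1 + y ^ 2)⁻¹ := by
          rw [div_pow, Real.sq_sqrt (by positivity)]; ring
  -- right of the strip: Plancherel for the Laplace transform
  have hright : ∀ σ : ℝ, b < σ → a < σ →
      (fun y : ℝ => ‖F (σ + y * I)‖ ^ 2) = fun y : ℝ => ‖laplaceC k (σ + y * I)‖ ^ 2 := by
    intro σ hσb hσ
    funext y
    rw [hFk _ (by rw [hre]; linarith) (by rw [hre]; exact hσ)]
  refine ⟨Real.sqrt M2, Real.sqrt_nonneg _, fun σ hσ => ?_, fun σ hσ => ?_⟩
  · by_cases hσb : σ ≤ b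
    · refine Integrable.mono' (integrable_inv_one_add_sq.const_mul (C ^ 2))
        ((hcont σ hσ).norm.pow 2).aestronglyMeasurable (Eventually.of_forall fun y => ?_)
      rw [Real.norm_eq_abs, abs_of_nonneg (by positivity)]
      exact hsq σ y hσ hσb
    · push Not at hσb
      rw [hright σ hσb hσ]
      exact hk.integrable_norm_sq_laplaceC_vertical (by linarith)
  · rw [Real.sq_sqrt hM2nn]
    by_cases hσb : σ ≤ b
    · calc ∫ y : ℝ, ‖F (σ + y * I)‖ ^ 2 ≤ ∫ y : ℝ, C ^ 2 * (1 + y ^ 2)⁻¹ :=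
            integral_mono_of_nonneg (Eventually.of_forall fun y => by positivity)
              (integrable_inv_one_add_sq.const_mul (C ^ 2)) (Eventually.of_forall fun y => hsq σ y hσ hσb)
        _ = π * C ^ 2 := by rw [integral_const_mul, integral_univ_inv_one_add_sq]; ring
        _ ≤ M2 := by rw [hM2]; linarith
    · push Not at hσb
      have hσγ : γ < σ := by linarith
      rw [hright σ hσb hσ, integral_norm_sq_laplaceC_vertical hk hσγ]
      have h1 := integral_norm_sq_bromwichDensity_le hk hσγ
      have h2 : K ^ 2 / (2 * (σ - γ)) ≤ K ^ 2 / (2 * d) := by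
        rw [hdb]
        exact div_le_div_of_nonneg_left (by positivity) (by linarith) (by linarith)
      calc 2 * π * ∫ t : ℝ, ‖bromwichDensity k σ t‖ ^ 2 ≤ 2 * π * (K ^ 2 / (2 * d)) := by
            gcongr; exact h1.trans h2
        _ = π * (K ^ 2 / d) := by field_simp
        _ ≤ M2 := by rw [hM2]; linarith

/-- **`[A′](a)` from the strip envelope.**  Hypotheses as in `hardy_of_strip_decay`; if moreover
`a < −γ′`, `γ′ = γ_ε + γ₂`, `γ₂ > 0`, then
`∫₀^∞ ‖k t‖ e^{γ_ε t} dt ≤ √( ((2π)⁻¹ ∫ ‖F(−γ′ + iω)‖² dω) / (2γ₂) )`. -/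
theorem Aprime_mass_le_of_strip_decay (hk : HalfLineExpBound k K γ) {a b C : ℝ} (hγb : γ < b)
    (hF : DifferentiableOn ℂ F {s : ℂ | a < s.re})
    (hFk : ∀ s : ℂ, γ < s.re → a < s.re → F s = laplaceC k s)
    (hC : ∀ σ y : ℝ, a < σ → σ ≤ b → ‖F (σ + y * I)‖ ≤ C / Real.sqrt (1 + y ^ 2))
    {γε γ₂ : ℝ} (hγ₂ : 0 < γ₂) (ha : a < -(γε + γ₂)) :
    ∫ t in Ioi (0 : ℝ), ‖k t‖ * Real.exp (γε * t)
      ≤ Real.sqrt (((2 * π)⁻¹ * ∫ ω : ℝ, ‖F ((-(γε + γ₂) : ℝ) + ω * I)‖ ^ 2) / (2 * γ₂)) := by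
  obtain ⟨M, hM, hI, hB⟩ := hardy_of_strip_decay hk hγb hF hFk hC
  exact ShiftedLineMass.Aprime_mass_le hk hM hF hI hB hFk hγ₂ ha

end Summit.AnomalousDissipation.SoloBlind.HardyFromDecay
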